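import Literature.NumberTheory.DiophantineGeometry.AbcShapeFourthMomentSets
import Literature.NumberTheory.DiophantineGeometry.AbcShapeFourierBound
import HarnessLib

/-!
# The Fourier bound with saved sets of variables (BBLT Prop. 3.1, arXiv v2)

[BernertEtAl2024, Prop. 3.1 (arXiv v2)]: for `2 ≤ j, k, ℓ ≤ d`,
`B_d ≪ X^{2λ/3+3ε₀} / (∏_{j∣i} Aᵢ ∏_{k∣i} Bᵢ ∏_{ℓ∣i} Cᵢ)^{1/6}`. From `B_d ≤ N(U,V,W)`, the
three arrangements `N⁴ ≤ E₄E₄E₂²` (`AbcShapeMoments`, `AbcShapeFourierBound`), the second moment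
`E₂ ≤ N D^d` and the set version of the fourth moment `E₄ ∏_{i∈S} ≤ 3 D^{3d+1} N³`
(`AbcShapeFourthMomentSets`) — multiplying the three arrangements gives
`N¹² ≤ ∏_T (E₄(T) E₂(T))²` — we get the explicit multiplicative form

> `B_d⁶ · (∏_{i∈S_U} Xᵢ)(∏_{i∈S_V} Yᵢ)(∏_{i∈S_W} Zᵢ) ≤ 27 D^{12d+3} (#box X #box Y #box Z)⁴`

(`AbcShapes.shapeCount_pow_six_mul_le_sets`) for any three sets `S_U, S_V, S_W` of coordinates
whose exponents `i + 1` are multiples of (possibly different) `e_U, e_V, e_W ≥ 2`. It supplies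
inequality (6.10) of [BernertEtAl2024, Prop. 6.1]. Theorems 1.2/1.3 (named facts of
`AbcExceptionalSetBounds`) are NOT proved here.

## References

* [BernertEtAl2024] C. Bernert, T. Browning, J. D. Lichtman, J. Teräväinen, *Bounds on the
  exceptional set in the abc conjecture*, arXiv:2410.12234v2, Proposition 3.1, (6.10).
-/

noncomputable section

open Finset

namespace Literature.NumberTheory.DiophantineGeometry

namespace AbcShapes

/-- `N(U,V,W)⁶ ≤ (E₄(U) E₂(U)) (E₄(V) E₂(V)) (E₄(W) E₂(W))` — the product of the three
arrangements of `N⁴ ≤ E₄ E₄ E₂²`, square-rooted. [cite: BernertEtAl2024, Proposition 3.1] -/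
theorem tripleCount_pow_six_le {d : ℕ} (c₁ c₂ c₃ : ℕ) (X Y Z : Fin d → ℕ) :
    tripleCount c₁ c₂ c₃ X Y Z ^ 6 ≤
      (energy4 c₁ X * energy2 c₁ X) * (energy4 c₂ Y * energy2 c₂ Y) *
        (energy4 c₃ Z * energy2 c₃ Z) := by
  set N := tripleCount c₁ c₂ c₃ X Y Z with hN
  have hA := tripleCount_pow_four_le c₁ c₂ c₃ X Y Z
  have hB : N ^ 4 ≤ energy4 c₁ X * energy4 c₃ Z * energy2 c₂ Y ^ 2 := by
    have h1 := tripleCount_sq_le_XZ c₁ c₂ c₃ X Y Z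
    have h2 := mixedEnergy_sq_le c₁ c₃ X Z
    calc N ^ 4 = (N ^ 2) ^ 2 := by ring
      _ ≤ (mixedEnergy c₁ X c₃ Z * energy2 c₂ Y) ^ 2 := Nat.pow_le_pow_left h1 2
      _ = mixedEnergy c₁ X c₃ Z ^ 2 * energy2 c₂ Y ^ 2 := by ring
      _ ≤ _ := Nat.mul_le_mul_right _ h2
  have hC : N ^ 4 ≤ energy4 c₂ Y * energy4 c₃ Z * energy2 c₁ X ^ 2 := by
    have h1 := tripleCount_sq_le_YZ c₁ c₂ c₃ X Y Z
    have h2 := mixedEnergy_sq_le c₂ c₃ Y Z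
    calc N ^ 4 = (N ^ 2) ^ 2 := by ring
      _ ≤ (mixedEnergy c₂ Y c₃ Z * energy2 c₁ X) ^ 2 := Nat.pow_le_pow_left h1 2
      _ = mixedEnergy c₂ Y c₃ Z ^ 2 * energy2 c₁ X ^ 2 := by ring
      _ ≤ _ := Nat.mul_le_mul_right _ h2
  have h12 : (N ^ 6) ^ 2 ≤ ((energy4 c₁ X * energy2 c₁ X) * (energy4 c₂ Y * energy2 c₂ Y) *
      (energy4 c₃ Z * energy2 c₃ Z)) ^ 2 := by
    calc (N ^ 6) ^ 2 = N ^ 4 * (N ^ 4 * N ^ 4) := by ring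
      _ ≤ (energy4 c₁ X * energy4 c₂ Y * energy2 c₃ Z ^ 2) *
          ((energy4 c₁ X * energy4 c₃ Z * energy2 c₂ Y ^ 2) *
            (energy4 c₂ Y * energy4 c₃ Z * energy2 c₁ X ^ 2)) :=
          Nat.mul_le_mul hA (Nat.mul_le_mul hB hC)
      _ = _ := by ring
  exact (Nat.pow_le_pow_iff_left two_ne_zero).mp h12

/-- **Fourier bound with saved sets, multiplicative form** [BernertEtAl2024, Prop. 3.1 (v2)]:
for `cᵢ ≥ 1`, boxes with positive parameters, sets `S_U, S_V, S_W` with `e_T ∣ i + 1` on `S_T`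
for some `e_T ≥ 2`, `T ≥ cᵢ ∏(2·)^{i+1}` and `τ(m) ≤ D` on `[1, T]`:
`B⁶ (∏_{S_U} Xᵢ)(∏_{S_V} Yᵢ)(∏_{S_W} Zᵢ) ≤ 27 D^{12d+3} (#box X #box Y #box Z)⁴`.
[cite: BernertEtAl2024, Proposition 3.1 (arXiv v2)] -/
theorem shapeCount_pow_six_mul_le_sets {d : ℕ} {c₁ c₂ c₃ : ℕ} (hc₁ : 0 < c₁) (hc₂ : 0 < c₂)
    (hc₃ : 0 < c₃) (X Y Z : Fin d → ℕ) (hX : ∀ i, 0 < X i) (hY : ∀ i, 0 < Y i)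
    (hZ : ∀ i, 0 < Z i) (SU SV SW : Finset (Fin d)) {eU eV eW : ℕ} (heU : 2 ≤ eU) (heV : 2 ≤ eV)
    (heW : 2 ≤ eW) (hSU : ∀ i ∈ SU, eU ∣ (i : ℕ) + 1) (hSV : ∀ i ∈ SV, eV ∣ (i : ℕ) + 1)
    (hSW : ∀ i ∈ SW, eW ∣ (i : ℕ) + 1) {T D : ℕ}
    (hTX : c₁ * shapeVal (fun i => 2 * X i) ≤ T) (hTY : c₂ * shapeVal (fun i => 2 * Y i) ≤ T)
    (hTZ : c₃ * shapeVal (fun i => 2 * Z i) ≤ T)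
    (hD : ∀ m : ℕ, m ≠ 0 → m ≤ T → m.divisors.card ≤ D) :
    shapeCount c₁ c₂ c₃ X Y Z ^ 6 * ((∏ i ∈ SU, X i) * (∏ i ∈ SV, Y i) * (∏ i ∈ SW, Z i)) ≤
      27 * D ^ (12 * d + 3) *
        ((dyadicBox X).card * (dyadicBox Y).card * (dyadicBox Z).card) ^ 4 := by
  set NX := (dyadicBox X).card with hNX
  set NY := (dyadicBox Y).card with hNY
  set NZ := (dyadicBox Z).card with hNZ
  have hE4X := energy4_mul_prod_le hc₁ X hX SU heU hSU (fun m hm hmT => hD m hm (hmT.trans hTX))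
  have hE4Y := energy4_mul_prod_le hc₂ Y hY SV heV hSV (fun m hm hmT => hD m hm (hmT.trans hTY))
  have hE4Z := energy4_mul_prod_le hc₃ Z hZ SW heW hSW (fun m hm hmT => hD m hm (hmT.trans hTZ))
  have hE2 : ∀ {c : ℕ} (_ : 0 < c) (W : Fin d → ℕ) (_ : ∀ i, 0 < W i)
      (_ : c * shapeVal (fun i => 2 * W i) ≤ T), energy2 c W ≤ (dyadicBox W).card * D ^ d := by
    intro c hc W hW hTW
    have hval : ∀ z ∈ dyadicBox W, shapeVal z ≠ 0 ∧ shapeVal z ≤ T := by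
      intro z hz
      have hzpos : ∀ i, 0 < z i := fun i => lt_of_lt_of_le (hW i) ((mem_dyadicBox.mp hz) i).1
      refine ⟨(shapeVal_pos hzpos).ne', ?_⟩
      calc shapeVal z ≤ shapeVal (fun i => 2 * W i) :=
            shapeVal_mono fun i => ((mem_dyadicBox.mp hz) i).2.le
        _ ≤ c * shapeVal (fun i => 2 * W i) := Nat.le_mul_of_pos_left _ hc
        _ ≤ T := hTW
    exact energy2_le hc W (fun z hz => hD _ (hval z hz).1 (hval z hz).2) fun z hz => (hval z hz).1
  have hBN := shapeCount_le_tripleCount c₁ c₂ c₃ X Y Z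
  have h6 := tripleCount_pow_six_le c₁ c₂ c₃ X Y Z
  calc shapeCount c₁ c₂ c₃ X Y Z ^ 6 * ((∏ i ∈ SU, X i) * (∏ i ∈ SV, Y i) * (∏ i ∈ SW, Z i))
      ≤ tripleCount c₁ c₂ c₃ X Y Z ^ 6 * ((∏ i ∈ SU, X i) * (∏ i ∈ SV, Y i) * (∏ i ∈ SW, Z i)) :=
        Nat.mul_le_mul_right _ (Nat.pow_le_pow_left hBN 6)
    _ ≤ (energy4 c₁ X * energy2 c₁ X) * (energy4 c₂ Y * energy2 c₂ Y) *
          (energy4 c₃ Z * energy2 c₃ Z) * ((∏ i ∈ SU, X i) * (∏ i ∈ SV, Y i) * (∏ i ∈ SW, Z i)) :=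
        Nat.mul_le_mul_right _ h6
    _ = (energy4 c₁ X * ∏ i ∈ SU, X i) * (energy4 c₂ Y * ∏ i ∈ SV, Y i) *
          (energy4 c₃ Z * ∏ i ∈ SW, Z i) * (energy2 c₁ X * energy2 c₂ Y * energy2 c₃ Z) := by ring
    _ ≤ (3 * D ^ (3 * d + 1) * NX ^ 3) * (3 * D ^ (3 * d + 1) * NY ^ 3) * (3 * D ^ (3 * d + 1) * NZ ^ 3) *
          ((NX * D ^ d) * (NY * D ^ d) * (NZ * D ^ d)) := by
        gcongr
        · exact hE2 hc₁ X hX hTX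
        · exact hE2 hc₂ Y hY hTY
        · exact hE2 hc₃ Z hZ hTZ
    _ = 27 * D ^ (12 * d + 3) * (NX * NY * NZ) ^ 4 := by ring

end AbcShapes

end Literature.NumberTheory.DiophantineGeometry
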